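import Summits.AtomisticToContinuum.Crystallization.Theorems.OverbindingBudgetAffineCompressedCutEstablish

/-!
# NODE g81 «Establish», part B: the O8 sign flips as explicit isometries, the PARENT LINK and TWO-PARENT ESTABLISHMENT (rider R2, engine half, file 2 of 2)

Route `OverbindingBudget` (Crystallization), crux `RobustDefectLimitWindows` (stmt-AtomisticToContinuum-31280), decomp-a2c lens 4, generation 81; open leaf
NS♭₂ ⟸ 79K ⟸ LR(r₁) ⟸ R1 «ExactStep» (delivered) → R2 → R3 → R4.  File 1 (`…CompressedCutEstablish`): `Estab`, `estab_child_one`, chart uniqueness.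

WHAT THIS FILE PROVES (potential-free, sorry-free).
* §1 (obligation O8 — the WLOG flip as an EXPLICIT ISOMETRY APPLIED TO EVERY CHART) `IsSign`, `flipLin` / `flipIso` (coordinate sign flips of `ℝ³` as
  linear isometries), `flipIso_mv : Φ_s (mv V) = mv (tflip s V)`, `tflip_tflip`, `flipIso_flipIso`, `carries_flip`, `carries_congr`, `carries_congr_map`,
  `mem_map_map_tflip`, `tflip_mem_fccL` / `mem_map_tflip_fccL` (`F⁺` is closed under all eight flips, by `decide`), ★ `carries_hcpFamily_normalise` (a chart
  onto a member of `hcpFamilyL` — the output of `…KernelGrowth.kf_hcp` — becomes after ONE flip a chart onto the aligned `H` or `H′`), ★ `estab_flip` (an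
  established site stays established, same `τ, D`, after composing its chart with `Φ_s` and the base frame with `Φ_s`), `lower_flip`.
* §2 ★★ `parent_link`: two sites `j₁, j₂` established onto the SAME `1`-separated copy `C` with labels differing by a first-shell vector `λ₂ − λ₁ ∈ C` that
  is an offset of a one-parent table with sole output `C` (in-layer rows of E1 / KF), positions resolving the two sites and links small against the base
  frame's lower bound: then `j₂` IS the site registered from `j₁` at `M_{j₁}⁻¹(mv (λ₂ − λ₁))` (metric exclusion) and `M_{j₂} = M_{j₁} ∘ R` for the exact
  dictionary `R` of the bond (chart uniqueness, file 1).  ★★ `estab_child_two`: TWO-PARENT ESTABLISHMENT at a lattice point `q` that is a cap point over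
  both (`q − λ₁, q − λ₂ ∈ capL C s`): the site registered from `j₁` at `M_{j₁}⁻¹(mv (q − λ₁))` is the site registered from `j₂` at `M_{j₂}⁻¹(mv (q − λ₂))`
  (metric exclusion), the three exact dictionaries satisfy the COCYCLE (`…Exact.exactDict_cocycle`, third point `a ∈ C`), hence BOTH parents give chart-form
  dictionaries for the child chart `M_{j₁} ∘ R₁` (`…Charts.chartDict_of_cocycle`) and the two-parent kernel table decides its copy
  (`…Charts.kernel_step_two`); the child is established at label `q`, link `τ₁ + (5/2)(2·10⁻⁴·nn_{j₁} + 10⁻⁴·nn_k)`, position `D₁ + 10⁻⁴·nn_{j₁} + τ₁`.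
HOW R2/R3 USE IT: R2 «Seed» grows the seed's layer disc by `estab_child_one` along basal bonds (tables E1 / KF, then ONE `estab_flip`), R3 «Stack» climbs
layers by `estab_child_two` (tables UP2 = `…KernelStackF/H`); all sites are charted in ONE aligned coordinate system, positions live only in the ledger (P)
(obligation O4), every identification is exact.

Deps: `…CompressedCutEstablish` (file 1).  No `instance`, no `notation`, no `set_option`, no new axioms, 0 sorry.
-/


namespace Summit.AtomisticToContinuum.Crystallization.Theorems.OverbindingBudgetAffineCompressedCutEstablishTwo

open Literature.Geometry.DiscreteGeometry (nearestDist nearestDist_nonneg nearestDist_le_dist exists_nearestDist_eq_dist fccTwoShellPattern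
  hcpTwoShellPattern card_eq_eighteen_of_twoShellPattern norm_le_sqrt_two_of_mem_twoShellPattern intVec intVec_apply)
open Summit.AtomisticToContinuum.Crystallization.Theorems.OverbindingBudgetAffineLadder (AffFramed)
open Summit.AtomisticToContinuum.Crystallization.Theorems.OverbindingBudgetAffineCompressedCutScale (affFramed_scale_transfer_record
  nearestDist_le_of_dist_le norm_frame_le one_sub_le_norm_frame)
open Summit.AtomisticToContinuum.Crystallization.Theorems.OverbindingBudgetAffineCompressedCutOp (op_of_tetra_bound_all)
open Summit.AtomisticToContinuum.Crystallization.Theorems.OverbindingBudgetAffineCompressedCutStep (tetra_exists_pattern)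
open Summit.AtomisticToContinuum.Crystallization.Theorems.OverbindingBudgetAffineCompressedCutKernel (T3 tsub tadd tneg tsq tdet thsum toV
  toV_apply_zero toV_apply_one toV_apply_two tflip fccL hcpL fccNegL hcpAltL hexL capL mem_capL hcpFamilyL kernelOneB kernelTwoB fccShellL kf_fcc
  kf_hcp)
open Summit.AtomisticToContinuum.Crystallization.Theorems.OverbindingBudgetAffineCompressedCutExact (ExactDict exact_step_record exactDict_cocycle
  linearMap_eq_of_eq_on_triple)
open Summit.AtomisticToContinuum.Crystallization.Theorems.OverbindingBudgetAffineCompressedCutCharts (mv mv_tadd mv_tsub mv_tneg mv_zero mv_injective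
  norm_mv_sq norm_mv_eq_one_iff ListedBy listedBy_fcc listedBy_hcp Carries carries_id_of_listedBy ChartDict chartDict_of_exactDict chartDict_of_cocycle
  kernel_step_one kernel_step_two linearIndependent_mv linearIndependent_of_chart)

open Summit.AtomisticToContinuum.Crystallization.Theorems.OverbindingBudgetAffineCompressedCutEstablish (site_eq_of_close Estab child_position
  bond_exact link_comp charts_close link_nonneg chart_eq_of_carries norm_sub_eq_one_of_chart tadd_tsub_cancel tsq_tsub_tsub)

variable {N : ℕ}

/-! ## §1  Coordinate sign flips as linear isometries (obligation O8: the WLOG flip applied to EVERY chart) -/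

/-- `s ∈ {±1}³`. [this file] -/
def IsSign (s : T3) : Prop := (s.1 = 1 ∨ s.1 = -1) ∧ (s.2.1 = 1 ∨ s.2.1 = -1) ∧ (s.2.2 = 1 ∨ s.2.2 = -1)

/-- The coordinate sign flip `x ↦ (s₁x₁, s₂x₂, s₃x₃)` as a linear map of `ℝ³`. [this file] -/
noncomputable def flipLin (s : T3) : EuclideanSpace ℝ (Fin 3) →ₗ[ℝ] EuclideanSpace ℝ (Fin 3) where
  toFun x := WithLp.toLp 2 fun t => ((toV s t : ℤ) : ℝ) * x t
  map_add' x z := by ext t; simp [mul_add]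
  map_smul' c x := by ext t; simp; ring

/-- Coordinates of `flipLin`. [this file] -/
theorem flipLin_apply (s : T3) (x : EuclideanSpace ℝ (Fin 3)) (t : Fin 3) : flipLin s x t = ((toV s t : ℤ) : ℝ) * x t := rfl

/-- Signs square to one. [this file] -/
private theorem sq_toV_sign {s : T3} (hs : IsSign s) (t : Fin 3) : ((toV s t : ℤ) : ℝ) ^ 2 = 1 := by
  fin_cases t
  · rcases hs.1 with h | h <;> simp [toV, h]
  · rcases hs.2.1 with h | h <;> simp [toV, h]
  · rcases hs.2.2 with h | h <;> simp [toV, h]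

/-- A sign flip preserves norms. [this file] -/
theorem norm_flipLin {s : T3} (hs : IsSign s) (x : EuclideanSpace ℝ (Fin 3)) : ‖flipLin s x‖ = ‖x‖ := by
  rw [EuclideanSpace.norm_eq, EuclideanSpace.norm_eq]
  congr 1
  refine Finset.sum_congr rfl fun t _ => ?_
  rw [flipLin_apply, Real.norm_eq_abs, Real.norm_eq_abs, sq_abs, sq_abs, mul_pow, sq_toV_sign hs, one_mul]

/-- ★ The sign flip `Φ_s` as a LINEAR ISOMETRY of `ℝ³` (O8). [this file] -/
noncomputable def flipIso (s : T3) (hs : IsSign s) : EuclideanSpace ℝ (Fin 3) →ₗᵢ[ℝ] EuclideanSpace ℝ (Fin 3) :=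
  ⟨flipLin s, norm_flipLin hs⟩

/-- `flipIso` is `flipLin`. [this file] -/
theorem flipIso_apply {s : T3} (hs : IsSign s) (x : EuclideanSpace ℝ (Fin 3)) : flipIso s hs x = flipLin s x := rfl

/-- `Φ_s` acts on model points by `tflip s`. [this file] -/
theorem flipIso_mv {s : T3} (hs : IsSign s) (V : T3) : flipIso s hs (mv V) = mv (tflip s V) := by
  rw [flipIso_apply]
  ext t
  fin_cases t <;> simp [flipLin_apply, mv, intVec, toV, tflip]

/-- `tflip s` is an involution for a sign `s`. [this file] -/
theorem tflip_tflip {s : T3} (hs : IsSign s) (V : T3) : tflip s (tflip s V) = V := by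
  obtain ⟨a, b, c⟩ := V
  obtain ⟨h1, h2, h3⟩ := hs
  simp only [tflip]
  rcases h1 with h1 | h1 <;> rcases h2 with h2 | h2 <;> rcases h3 with h3 | h3 <;> simp [h1, h2, h3]

/-- `Φ_s` is an involution. [this file] -/
theorem flipIso_flipIso {s : T3} (hs : IsSign s) (x : EuclideanSpace ℝ (Fin 3)) : flipIso s hs (flipIso s hs x) = x := by
  ext t
  rw [flipIso_apply, flipIso_apply, flipLin_apply, flipLin_apply, ← mul_assoc, ← sq, sq_toV_sign hs t, one_mul]

/-- Composing a chart with `Φ_s` carries the pattern onto the flipped copy. [this file] -/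
theorem carries_flip {s : T3} (hs : IsSign s) {M : EuclideanSpace ℝ (Fin 3) →ₗᵢ[ℝ] EuclideanSpace ℝ (Fin 3)}
    {P : Finset (EuclideanSpace ℝ (Fin 3))} {C : List T3} (h : Carries M P C) : Carries ((flipIso s hs).comp M) P (C.map (tflip s)) := by
  refine ⟨fun v hv => ?_, fun V hV => ?_⟩
  · obtain ⟨V, hV, hMV⟩ := h.1 v hv
    exact ⟨tflip s V, List.mem_map.2 ⟨V, hV, rfl⟩, by rw [LinearIsometry.coe_comp, Function.comp_apply, hMV, flipIso_mv]⟩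
  · obtain ⟨W, hW, rfl⟩ := List.mem_map.1 hV
    obtain ⟨v, hv, hMv⟩ := h.2 W hW
    exact ⟨v, hv, by rw [LinearIsometry.coe_comp, Function.comp_apply, hMv, flipIso_mv]⟩

/-- `Carries` only depends on the members of the copy list. [this file] -/
theorem carries_congr {M : EuclideanSpace ℝ (Fin 3) →ₗᵢ[ℝ] EuclideanSpace ℝ (Fin 3)} {P : Finset (EuclideanSpace ℝ (Fin 3))} {C C' : List T3}
    (hCC : ∀ V, V ∈ C ↔ V ∈ C') (h : Carries M P C) : Carries M P C' := by
  refine ⟨fun v hv => ?_, fun V hV => h.2 V ((hCC V).2 hV)⟩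
  obtain ⟨V, hV, hMV⟩ := h.1 v hv
  exact ⟨V, (hCC V).1 hV, hMV⟩

/-- `Carries` only depends on the values of the chart. [this file] -/
theorem carries_congr_map {M G : EuclideanSpace ℝ (Fin 3) →ₗᵢ[ℝ] EuclideanSpace ℝ (Fin 3)} {P : Finset (EuclideanSpace ℝ (Fin 3))} {C : List T3}
    (hMG : ∀ x, M x = G x) (h : Carries M P C) : Carries G P C := by
  refine ⟨fun v hv => ?_, fun V hV => ?_⟩
  · obtain ⟨V, hV, hMV⟩ := h.1 v hv
    exact ⟨V, hV, by rw [← hMG, hMV]⟩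
  · obtain ⟨v, hv, hMv⟩ := h.2 V hV
    exact ⟨v, hv, by rw [← hMG, hMv]⟩

/-- Flipping twice lists the same members. [this file] -/
theorem mem_map_map_tflip {s : T3} (hs : IsSign s) (L : List T3) : ∀ V, V ∈ (L.map (tflip s)).map (tflip s) ↔ V ∈ L := by
  intro V
  constructor
  · intro hV
    obtain ⟨W, hW, rfl⟩ := List.mem_map.1 hV
    obtain ⟨U, hU, rfl⟩ := List.mem_map.1 hW
    rw [tflip_tflip hs]
    exact hU
  · intro hV
    exact List.mem_map.2 ⟨tflip s V, List.mem_map.2 ⟨V, hV, rfl⟩, tflip_tflip hs V⟩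

/-- The aligned fcc copy `F⁺` is closed under all eight sign flips (by `decide`). [this file] -/
theorem tflip_mem_fccL {s V : T3} (hs : IsSign s) (hV : V ∈ fccL) : tflip s V ∈ fccL := by
  have key : ∀ σ ∈ [((1 : ℤ), (1 : ℤ), (1 : ℤ)), (1, 1, -1), (1, -1, 1), (1, -1, -1), (-1, 1, 1), (-1, 1, -1), (-1, -1, 1), (-1, -1, -1)],
      ∀ W ∈ fccL, tflip σ W ∈ fccL := by decide
  have hmem : s ∈ [((1 : ℤ), (1 : ℤ), (1 : ℤ)), (1, 1, -1), (1, -1, 1), (1, -1, -1), (-1, 1, 1), (-1, 1, -1), (-1, -1, 1), (-1, -1, -1)] := by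
    obtain ⟨a, b, c⟩ := s
    obtain ⟨h1, h2, h3⟩ := hs
    simp only at h1 h2 h3
    rcases h1 with rfl | rfl <;> rcases h2 with rfl | rfl <;> rcases h3 with rfl | rfl <;> simp
  exact key s hmem V hV

/-- Hence the flipped list `fccL.map (tflip s)` has the same members as `fccL`. [this file] -/
theorem mem_map_tflip_fccL {s : T3} (hs : IsSign s) : ∀ V, V ∈ fccL.map (tflip s) ↔ V ∈ fccL := by
  intro V
  constructor
  · intro hV
    obtain ⟨W, hW, rfl⟩ := List.mem_map.1 hV
    exact tflip_mem_fccL hs hW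
  · intro hV
    exact List.mem_map.2 ⟨tflip s V, tflip_mem_fccL hs hV, tflip_tflip hs V⟩

/-- ★ **O8 NORMALISATION.**  A chart onto a member of `hcpFamilyL` (the eight hcp copies adjacent to `F⁺`, `…KernelGrowth.kf_hcp`) becomes, after composing
with ONE sign flip `Φ_s`, a chart onto the aligned copy `H` or `H′`. [this file] -/
theorem carries_hcpFamily_normalise {M : EuclideanSpace ℝ (Fin 3) →ₗᵢ[ℝ] EuclideanSpace ℝ (Fin 3)} {P : Finset (EuclideanSpace ℝ (Fin 3))}
    {Q : List T3} (hQ : Q ∈ hcpFamilyL) (hM : Carries M P Q) :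
    ∃ s : T3, ∃ hs : IsSign s, Carries ((flipIso s hs).comp M) P hcpL ∨ Carries ((flipIso s hs).comp M) P hcpAltL := by
  simp only [hcpFamilyL, List.mem_flatMap, List.mem_cons, List.not_mem_nil, or_false] at hQ
  obtain ⟨s, hs4, hQ⟩ := hQ
  have hs : IsSign s := by
    rcases hs4 with rfl | rfl | rfl | rfl
    · exact ⟨Or.inl rfl, Or.inl rfl, Or.inl rfl⟩
    · exact ⟨Or.inl rfl, Or.inl rfl, Or.inr rfl⟩
    · exact ⟨Or.inl rfl, Or.inr rfl, Or.inl rfl⟩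
    · exact ⟨Or.inr rfl, Or.inl rfl, Or.inl rfl⟩
  refine ⟨s, hs, ?_⟩
  rcases hQ with rfl | rfl
  · exact Or.inl (carries_congr (mem_map_map_tflip hs hcpL) (carries_flip hs hM))
  · exact Or.inr (carries_congr (mem_map_map_tflip hs hcpAltL) (carries_flip hs hM))

/-- ★ **O8: FLIPPING EVERYTHING.**  An established site stays established, with the same `τ, D`, after composing its chart with `Φ_s`, precomposing the base
frame with `Φ_s`, flipping its copy list and its label. [this file] -/
theorem estab_flip {s : T3} (hs : IsSign s) {y : Fin N → EuclideanSpace ℝ (Fin 3)}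
    {A : Fin N → (EuclideanSpace ℝ (Fin 3) →ₗ[ℝ] EuclideanSpace ℝ (Fin 3))} {P : Fin N → Finset (EuclideanSpace ℝ (Fin 3))}
    {B : EuclideanSpace ℝ (Fin 3) →ₗ[ℝ] EuclideanSpace ℝ (Fin 3)} {i j : Fin N} {M : EuclideanSpace ℝ (Fin 3) →ₗᵢ[ℝ] EuclideanSpace ℝ (Fin 3)}
    {C : List T3} {lam : T3} {τ D : ℝ} (hE : Estab y A P B i j M C lam τ D) :
    Estab y A P (B ∘ₗ (flipIso s hs).toLinearMap) i j ((flipIso s hs).comp M) (C.map (tflip s)) (tflip s lam) τ D := by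
  obtain ⟨hC, hl, hp⟩ := hE
  refine ⟨carries_flip hs hC, fun x => ?_, ?_⟩
  · rw [LinearMap.comp_apply, LinearIsometry.coe_toLinearMap, LinearIsometry.coe_comp, Function.comp_apply, flipIso_flipIso]
    exact hl x
  · rw [LinearMap.comp_apply, LinearIsometry.coe_toLinearMap, flipIso_mv, tflip_tflip hs]
    exact hp

/-- A lower operator bound of the base frame survives the flip. [this file] -/
theorem lower_flip {s : T3} (hs : IsSign s) {B : EuclideanSpace ℝ (Fin 3) →ₗ[ℝ] EuclideanSpace ℝ (Fin 3)} {β : ℝ}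
    (hB : ∀ z, β * ‖z‖ ≤ ‖B z‖) : ∀ z, β * ‖z‖ ≤ ‖(B ∘ₗ (flipIso s hs).toLinearMap) z‖ := by
  intro z
  rw [LinearMap.comp_apply, LinearIsometry.coe_toLinearMap]
  have h := hB (flipIso s hs z)
  rwa [LinearIsometry.norm_map] at h

/-! ## §2  The parent link and TWO-PARENT ESTABLISHMENT -/

/-- ★★ **PARENT LINK** (in-copy compatibility of two established neighbours).  `j₁, j₂` established onto the SAME `1`-separated copy `C` with labels differing
by a first-shell vector `λ₂ − λ₁ ∈ C`, listed in the offset list of a one-parent table whose only output is `C` itself (the in-layer rows of E1 / KF); the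
positions resolve the two sites (`Δ < nn_{j₂}`) and the accumulated links are small against the base frame's lower bound.  Then `j₂` IS the site registered
from `j₁` at `M_{j₁}⁻¹(mv (λ₂ − λ₁))` (metric exclusion), and `M_{j₂} = M_{j₁} ∘ R` for the exact dictionary `R` of that bond (chart uniqueness). [this file] -/
theorem parent_link {y : Fin N → EuclideanSpace ℝ (Fin 3)} (hy : Function.Injective y) {r : ℝ} {i j₁ j₂ : Fin N}
    {A : Fin N → (EuclideanSpace ℝ (Fin 3) →ₗ[ℝ] EuclideanSpace ℝ (Fin 3))} {Qf : Fin N → (EuclideanSpace ℝ (Fin 3) →ₗᵢ[ℝ] EuclideanSpace ℝ (Fin 3))}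
    {P : Fin N → Finset (EuclideanSpace ℝ (Fin 3))} {f : Fin N → EuclideanSpace ℝ (Fin 3) → EuclideanSpace ℝ (Fin 3)}
    {B : EuclideanSpace ℝ (Fin 3) →ₗ[ℝ] EuclideanSpace ℝ (Fin 3)} {β : ℝ}
    (hP : ∀ j, dist (y j) (y i) ≤ r → (P j = fccTwoShellPattern ∨ P j = hcpTwoShellPattern))
    (hA : ∀ j, dist (y j) (y i) ≤ r → ∀ v ∈ P j, ‖A j v - Qf j v‖ ≤ 1 / 1000)
    (hf : ∀ j, dist (y j) (y i) ≤ r → ∀ v ∈ P j, f j v ∈ Set.range y ∧ dist (f j v) (y j + nearestDist y j • A j v) ≤ 1 / 10 ^ 4 * nearestDist y j)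
    (hinj : ∀ j, dist (y j) (y i) ≤ r → Set.InjOn (f j) ↑(P j))
    (hex : ∀ j, dist (y j) (y i) ≤ r → ∀ m, m ≠ j → dist (y m) (y j) ≤ (3 / 2 + 1 / 450) * nearestDist y j → ∃ v ∈ P j, f j v = y m)
    (hj₁ : dist (y j₁) (y i) ≤ r) (hj₂ : dist (y j₂) (y i) ≤ r) (hB : ∀ z, β * ‖z‖ ≤ ‖B z‖)
    {M₁ M₂ : EuclideanSpace ℝ (Fin 3) →ₗᵢ[ℝ] EuclideanSpace ℝ (Fin 3)} {C : List T3} {lam₁ lam₂ : T3} {τ₁ τ₂ D₁ D₂ : ℝ}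
    (hE₁ : Estab y A P B i j₁ M₁ C lam₁ τ₁ D₁) (hE₂ : Estab y A P B i j₂ M₂ C lam₂ τ₂ D₂)
    (hsep : ∀ V ∈ C, ∀ W ∈ C, V ≠ W → 18 ≤ tsq (tsub V W)) (hClen : C.length ≤ 18)
    (he : tsub lam₂ lam₁ ∈ C) (he18 : tsq (tsub lam₂ lam₁) = 18) {xs : List T3} (hexs : tsub lam₂ lam₁ ∈ xs)
    {S₂ : List T3} (hS₂ : S₂ = fccL ∨ S₂ = hcpL) (hL₂ : ListedBy (P j₂) S₂) {Q1 : List (List T3)} (hK1 : kernelOneB C xs S₂ Q1 = true)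
    (hQ1 : ∀ Q ∈ Q1, Q = C) (hΔ : (D₁ + 1 / 10 ^ 4 * nearestDist y j₁ + τ₁) + D₂ < nearestDist y j₂)
    (hsmall : (τ₁ + 5 / 2 * (2 * (1 / 10 ^ 4) * nearestDist y j₁ + 1 / 10 ^ 4 * nearestDist y j₂) + τ₂) * Real.sqrt 2 < β) :
    ∃ e ∈ P j₁, M₁ e = mv (tsub lam₂ lam₁) ∧ f j₁ e = y j₂ ∧ j₂ ≠ j₁ ∧
      9967 / 10000 * nearestDist y j₁ ≤ nearestDist y j₂ ∧ nearestDist y j₂ ≤ 10011 / 10000 * nearestDist y j₁ ∧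
      ∃ R : EuclideanSpace ℝ (Fin 3) →ₗᵢ[ℝ] EuclideanSpace ℝ (Fin 3), ExactDict y j₁ (P j₁) (P j₂) (f j₁) (f j₂) e R ∧ ∀ x, M₂ x = M₁ (R x) := by
  obtain ⟨e, he', hMe⟩ := hE₁.1.2 _ he
  have he1 : ‖e‖ = 1 := by
    have h := (norm_mv_eq_one_iff _).2 he18
    rwa [← hMe, M₁.norm_map] at h
  obtain ⟨m, hm⟩ := (hf j₁ hj₁ e he').1
  have hposm := child_position hE₁ (hf j₁ hj₁) he' he1 hMe hm.symm
  rw [tadd_tsub_cancel] at hposm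
  have hmj : m = j₂ := site_eq_of_close hposm hE₂.2.2 hΔ
  rw [hmj] at hm
  obtain ⟨hj₂₁, hsc, hsc', R, hop, hD⟩ := bond_exact hy hP hA hf hinj hex hj₁ hj₂ he' he1 hm.symm
  refine ⟨e, he', hMe, hm.symm, hj₂₁, hsc, hsc', R, hD, ?_⟩
  have hDc : ChartDict (M₁.comp R) M₁ (P j₁) e (P j₂) := chartDict_of_exactDict M₁ hD
  have hcard : (P j₂).card = 18 := card_eq_eighteen_of_twoShellPattern (hP j₂ hj₂)
  have hlen : ∀ Q ∈ Q1, Q.length ≤ 18 := fun Q hQ => by rw [hQ1 Q hQ]; exact hClen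
  obtain ⟨Q, hQ, hCQ⟩ := kernel_step_one hK1 hexs hDc hE₁.1 hMe he1 hS₂ hL₂ hcard hlen
  rw [hQ1 Q hQ] at hCQ
  have hlG := link_comp hE₁.2.1 hop
  have hcl := charts_close hB hlG hE₂.2.1
  have hτ₁ := link_nonneg hlG
  have hτ₂ := link_nonneg hE₂.2.1
  have hβ : 0 < β := lt_of_le_of_lt (mul_nonneg (by linarith) (Real.sqrt_nonneg 2)) hsmall
  have hclose : ∀ v ∈ P j₂, ‖(M₁.comp R) v - M₂ v‖ < 1 := by
    intro v hv
    have h1 := hcl v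
    have h2 : ‖v‖ ≤ Real.sqrt 2 := norm_le_sqrt_two_of_mem_twoShellPattern (hP j₂ hj₂) hv
    have h3 : (τ₁ + 5 / 2 * (2 * (1 / 10 ^ 4) * nearestDist y j₁ + 1 / 10 ^ 4 * nearestDist y j₂) + τ₂) * ‖v‖ ≤
        (τ₁ + 5 / 2 * (2 * (1 / 10 ^ 4) * nearestDist y j₁ + 1 / 10 ^ 4 * nearestDist y j₂) + τ₂) * Real.sqrt 2 :=
      mul_le_mul_of_nonneg_left h2 (by linarith)
    exact (mul_lt_iff_lt_one_right hβ).1 (by linarith)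
  have heq := chart_eq_of_carries hS₂ hL₂ hsep hCQ hE₂.1 hclose
  intro x
  rw [← heq x, LinearIsometry.coe_comp, Function.comp_apply]

/-- ★★ **TWO-PARENT ESTABLISHMENT.**  Two established in-copy neighbours `j₁, j₂` as in `parent_link`, a lattice point `q` that is a CAP POINT over both
(`q − λ₁, q − λ₂ ∈ capL C s`), a third copy vector `a ∈ C` adjacent to `q − λ₁` and to `λ₂ − λ₁` and independent of them (the cocycle's third point), the
two two-parent kernel tables (fcc child ↦ `Q2f`, hcp child ↦ `Q2h`), the child's predicted position in the ball and resolved from `j₂`'s prediction.  Then the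
site `k` registered from `j₁` at `M_{j₁}⁻¹(mv (q − λ₁))` is established at label `q` with chart `M_{j₁} ∘ R₁` onto a copy of the matching table, link
`τ₁ + (5/2)(2·10⁻⁴·nn_{j₁} + 10⁻⁴·nn_k)`, position `D₁ + 10⁻⁴·nn_{j₁} + τ₁`.  Mechanism: exact dictionaries of the three bonds, the COCYCLE
(`…Exact.exactDict_cocycle`), `parent_link`, `…Charts.chartDict_of_cocycle` and `…Charts.kernel_step_two`. [this file] -/
theorem estab_child_two {y : Fin N → EuclideanSpace ℝ (Fin 3)} (hy : Function.Injective y) {r : ℝ} {i j₁ j₂ : Fin N}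
    {A : Fin N → (EuclideanSpace ℝ (Fin 3) →ₗ[ℝ] EuclideanSpace ℝ (Fin 3))} {Qf : Fin N → (EuclideanSpace ℝ (Fin 3) →ₗᵢ[ℝ] EuclideanSpace ℝ (Fin 3))}
    {P : Fin N → Finset (EuclideanSpace ℝ (Fin 3))} {f : Fin N → EuclideanSpace ℝ (Fin 3) → EuclideanSpace ℝ (Fin 3)}
    {B : EuclideanSpace ℝ (Fin 3) →ₗ[ℝ] EuclideanSpace ℝ (Fin 3)} {β : ℝ}
    (hP : ∀ j, dist (y j) (y i) ≤ r → (P j = fccTwoShellPattern ∨ P j = hcpTwoShellPattern))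
    (hA : ∀ j, dist (y j) (y i) ≤ r → ∀ v ∈ P j, ‖A j v - Qf j v‖ ≤ 1 / 1000)
    (hf : ∀ j, dist (y j) (y i) ≤ r → ∀ v ∈ P j, f j v ∈ Set.range y ∧ dist (f j v) (y j + nearestDist y j • A j v) ≤ 1 / 10 ^ 4 * nearestDist y j)
    (hinj : ∀ j, dist (y j) (y i) ≤ r → Set.InjOn (f j) ↑(P j))
    (hex : ∀ j, dist (y j) (y i) ≤ r → ∀ m, m ≠ j → dist (y m) (y j) ≤ (3 / 2 + 1 / 450) * nearestDist y j → ∃ v ∈ P j, f j v = y m)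
    (hj₁ : dist (y j₁) (y i) ≤ r) (hj₂ : dist (y j₂) (y i) ≤ r) (hB : ∀ z, β * ‖z‖ ≤ ‖B z‖)
    {M₁ M₂ : EuclideanSpace ℝ (Fin 3) →ₗᵢ[ℝ] EuclideanSpace ℝ (Fin 3)} {C : List T3} {lam₁ lam₂ : T3} {τ₁ τ₂ D₁ D₂ : ℝ}
    (hE₁ : Estab y A P B i j₁ M₁ C lam₁ τ₁ D₁) (hE₂ : Estab y A P B i j₂ M₂ C lam₂ τ₂ D₂)
    (hsep : ∀ V ∈ C, ∀ W ∈ C, V ≠ W → 18 ≤ tsq (tsub V W)) (hClen : C.length ≤ 18)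
    (he : tsub lam₂ lam₁ ∈ C) (he18 : tsq (tsub lam₂ lam₁) = 18) {xs : List T3} (hexs : tsub lam₂ lam₁ ∈ xs)
    {S₂ : List T3} (hS₂ : S₂ = fccL ∨ S₂ = hcpL) (hL₂ : ListedBy (P j₂) S₂) {Q1 : List (List T3)} (hK1 : kernelOneB C xs S₂ Q1 = true)
    (hQ1 : ∀ Q ∈ Q1, Q = C) (hΔ : (D₁ + 1 / 10 ^ 4 * nearestDist y j₁ + τ₁) + D₂ < nearestDist y j₂)
    (hsmall : (τ₁ + 5 / 2 * (2 * (1 / 10 ^ 4) * nearestDist y j₁ + 1 / 10 ^ 4 * nearestDist y j₂) + τ₂) * Real.sqrt 2 < β)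
    {q : T3} {sg : ℤ} (hx : tsub q lam₁ ∈ capL C sg) (hx₂ : tsub q lam₂ ∈ capL C sg)
    {a : T3} (haC : a ∈ C) (hax : tsq (tsub a (tsub q lam₁)) = 18) (hae : tsq (tsub a (tsub lam₂ lam₁)) = 18)
    (hdet : tdet (tsub q lam₁) (tsub lam₂ lam₁) a ≠ 0)
    {Q2f Q2h : List (List T3)} (hK2f : kernelTwoB C sg fccL Q2f = true) (hK2h : kernelTwoB C sg hcpL Q2h = true)
    (hl2f : ∀ Q ∈ Q2f, Q.length ≤ 18) (hl2h : ∀ Q ∈ Q2h, Q.length ≤ 18)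
    (hΔk : (D₁ + 1 / 10 ^ 4 * nearestDist y j₁ + τ₁) + (D₂ + 1 / 10 ^ 4 * nearestDist y j₂ + τ₂) < 9967 / 10000 * nearestDist y j₁)
    (hball : ‖B (mv q)‖ + (D₁ + 1 / 10 ^ 4 * nearestDist y j₁ + τ₁) ≤ r) :
    ∃ k : Fin N, ∃ v ∈ P j₁, M₁ v = mv (tsub q lam₁) ∧ f j₁ v = y k ∧ k ≠ j₁ ∧ dist (y k) (y i) ≤ r ∧
      9967 / 10000 * nearestDist y j₁ ≤ nearestDist y k ∧ nearestDist y k ≤ 10011 / 10000 * nearestDist y j₁ ∧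
      ∃ R₁ : EuclideanSpace ℝ (Fin 3) →ₗᵢ[ℝ] EuclideanSpace ℝ (Fin 3), ExactDict y j₁ (P j₁) (P k) (f j₁) (f k) v R₁ ∧
        ∃ Q : List T3, ((P k = fccTwoShellPattern ∧ Q ∈ Q2f) ∨ (P k = hcpTwoShellPattern ∧ Q ∈ Q2h)) ∧
          Estab y A P B i k (M₁.comp R₁) Q q
            (τ₁ + 5 / 2 * (2 * (1 / 10 ^ 4) * nearestDist y j₁ + 1 / 10 ^ 4 * nearestDist y k)) (D₁ + 1 / 10 ^ 4 * nearestDist y j₁ + τ₁) := by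
  -- the first parent's bond to the child
  obtain ⟨hxC, hx18, -⟩ := mem_capL.1 hx
  obtain ⟨hx₂C, hx₂18, -⟩ := mem_capL.1 hx₂
  obtain ⟨v, hv, hMv⟩ := hE₁.1.2 _ hxC
  have hv1 : ‖v‖ = 1 := by
    have h := (norm_mv_eq_one_iff _).2 hx18
    rwa [← hMv, M₁.norm_map] at h
  obtain ⟨k, hk⟩ := (hf j₁ hj₁ v hv).1
  have hposk := child_position hE₁ (hf j₁ hj₁) hv hv1 hMv hk.symm
  rw [tadd_tsub_cancel] at hposk
  have hkr : dist (y k) (y i) ≤ r := by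
    rw [dist_eq_norm]
    have e : y k - y i = (y k - y i - B (mv q)) + B (mv q) := by abel
    rw [e]
    exact (norm_add_le _ _).trans (by linarith)
  obtain ⟨hkj₁, hsck, hsck', R₁, hop₁, hD₁⟩ := bond_exact hy hP hA hf hinj hex hj₁ hkr hv hv1 hk.symm
  -- the parent link
  obtain ⟨e, he', hMe, hfe, hj₂₁, -, -, R, hDR, hM₂⟩ := parent_link hy hP hA hf hinj hex hj₁ hj₂ hB hE₁ hE₂ hsep hClen he he18 hexs hS₂ hL₂ hK1 hQ1
    hΔ hsmall
  -- the second parent's bond to the SAME child (metric exclusion)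
  obtain ⟨v', hv', hMv'⟩ := hE₂.1.2 _ hx₂C
  have hv'1 : ‖v'‖ = 1 := by
    have h := (norm_mv_eq_one_iff _).2 hx₂18
    rwa [← hMv', M₂.norm_map] at h
  obtain ⟨k', hk'⟩ := (hf j₂ hj₂ v' hv').1
  have hposk' := child_position hE₂ (hf j₂ hj₂) hv' hv'1 hMv' hk'.symm
  rw [tadd_tsub_cancel] at hposk'
  have hkk : k' = k := site_eq_of_close hposk' hposk (by linarith)
  rw [hkk] at hk'
  obtain ⟨-, -, -, R₁', -, hD₁'⟩ := bond_exact hy hP hA hf hinj hex hj₂ hkr hv' hv'1 hk'.symm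
  -- the cocycle's third point and the cocycle
  obtain ⟨ar, har, hMa⟩ := hE₁.1.2 _ haC
  have hev : ‖e - v‖ = 1 := norm_sub_eq_one_of_chart M₁ hMe hMv (by rw [tsq_tsub_tsub]; exact hx₂18)
  have hav : ‖ar - v‖ = 1 := norm_sub_eq_one_of_chart M₁ hMa hMv hax
  have haev : ‖ar - e‖ = 1 := norm_sub_eq_one_of_chart M₁ hMa hMe hae
  have ne1 : e ≠ v := fun h => by rw [h, sub_self, norm_zero] at hev; exact zero_ne_one hev
  have ne2 : ar ≠ v := fun h => by rw [h, sub_self, norm_zero] at hav; exact zero_ne_one hav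
  have ne3 : ar ≠ e := fun h => by rw [h, sub_self, norm_zero] at haev; exact zero_ne_one haev
  have hli : LinearIndependent ℝ ![v, e, ar] := linearIndependent_of_chart M₁ hMv hMe hMa hdet
  have hc := exactDict_cocycle (hinj j₂ hj₂) (hinj k hkr) hv hv1 he' har hk.symm hfe hv' hk'.symm ne1 (by rw [hev]; norm_num) ne2
    (by rw [hav]; norm_num) ne3 (by rw [haev]; norm_num) hli hDR hD₁ hD₁'
  -- the two chart-form dictionaries of the child chart
  have hDc : ChartDict (M₁.comp R₁) M₁ (P j₁) v (P k) := chartDict_of_exactDict M₁ hD₁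
  have hDc₂ : ChartDict (M₁.comp R₁) (M₁.comp R) (P j₂) v' (P k) := chartDict_of_cocycle M₁ hD₁' hc
  have hC₂ : Carries (M₁.comp R) (P j₂) C :=
    carries_congr_map (fun x => by rw [hM₂ x, LinearIsometry.coe_comp, Function.comp_apply]) hE₂.1
  have hGx₂ : (M₁.comp R) v' = mv (tsub q lam₂) := by rw [LinearIsometry.coe_comp, Function.comp_apply, ← hM₂ v', hMv']
  have hne : tsub q lam₁ ≠ tsub q lam₂ := by
    intro h
    have h0 : tsq (tsub (tsub q lam₂) (tsub q lam₁)) = 0 := by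
      rw [h]
      obtain ⟨a₁, a₂, a₃⟩ := tsub q lam₂
      simp [tsq, tsub]
    have h1 : tsq (tsub (tsub q lam₂) (tsub q lam₁)) = tsq (tsub lam₂ lam₁) := by
      obtain ⟨a₁, a₂, a₃⟩ := q
      obtain ⟨b₁, b₂, b₃⟩ := lam₁
      obtain ⟨c₁, c₂, c₃⟩ := lam₂
      simp only [tsq, tsub]
      ring
    rw [h1, he18] at h0
    exact absurd h0 (by norm_num)
  have hcard : (P k).card = 18 := card_eq_eighteen_of_twoShellPattern (hP k hkr)
  have hlink' := link_comp hE₁.2.1 hop₁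
  refine ⟨k, v, hv, hMv, hk.symm, hkj₁, hkr, hsck, hsck', R₁, hD₁, ?_⟩
  rcases hP k hkr with hPk | hPk
  · have hL : ListedBy (P k) fccL := by rw [hPk]; exact listedBy_fcc
    obtain ⟨Q, hQ, hCQ⟩ := kernel_step_two hK2f hx hx₂ hne hDc hE₁.1 hMv hv1 hDc₂ hC₂ hGx₂ (Or.inl rfl) hL hcard hl2f
    exact ⟨Q, Or.inl ⟨hPk, hQ⟩, hCQ, hlink', hposk⟩
  · have hL : ListedBy (P k) hcpL := by rw [hPk]; exact listedBy_hcp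
    obtain ⟨Q, hQ, hCQ⟩ := kernel_step_two hK2h hx hx₂ hne hDc hE₁.1 hMv hv1 hDc₂ hC₂ hGx₂ (Or.inr rfl) hL hcard hl2h
    exact ⟨Q, Or.inr ⟨hPk, hQ⟩, hCQ, hlink', hposk⟩

end Summit.AtomisticToContinuum.Crystallization.Theorems.OverbindingBudgetAffineCompressedCutEstablishTwo
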